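import Mathlib
import Summits.NavierStokesRegularity.NavierStokesRegularity.Theorems.FilamentSkeletonRssKelvinGatePressureDecayK

/-!
# Route `FilamentSkeletonRss` · cruxes `TransverseReductionRJ` (stmt-21221, aside) / `TransverseReduction1A` (stmt-27414) —
# line `kelvin_gate`: WEIGHTED RIESZ-TYPE INTEGRALS `∫ |x − y|^{-p} (1+|y|)^{-k} dy ≤ C V (1+|x|)^{3−p−k}`

Helper file (theorems only, `--as helper`).  HONEST FRAMING: analysis bookkeeping for a HYPOTHETICAL filament-type rotating
self-similar blow-up route; nothing here bears on Navier–Stokes regularity; no stub is proved here.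

Two-exponent version of the three-region estimate of `…KelvinGatePressureDecay` (`p = 2`, `k = 2`) and `…PressureDecayK` (`p = 2`):
for `0 < p < 3`, `0 ≤ k < 3`, `p + k > 3` and every `x ∈ ℝ³`,

  `∫ |x − y|^{-p} (1+|y|)^{-k} dy ≤ C_{p,k} V (1+|x|)^{3−p−k}`,  `C_{p,k} = 2^{p+k−3}/(3−p) + 2^{p+3−k}/(3−k) + 2^{3−k}/(p+k−3)`, `V = 3|B₁|`

(near ball `B(x,(1+|x|)/2)`, the rest of `B(0,2(1+|x|))`, the exterior; radial integrals `lintegral_ball_norm_rpow_neg` /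
`lintegral_compl_ball_norm_rpow_neg` of the tree).  Used with `p = 2 + γ` for the weighted Hölder modulus of the dipole potential
(piece (m2) of SHARP-WEIGHTS-DESIGN-21221-g7) and with `p = 2` for its size.
-/

set_option linter.dupNamespace false

noncomputable section

namespace Summit.NavierStokesRegularity.NavierStokesRegularity.Theorems.KelvinGate

open Set Function Filter MeasureTheory Metric Real
open Literature.Analysis.FluidPDE Literature.Analysis.FluidPDE.NewtonPotentialHolder
open scoped ENNReal Topology

/-- Off the near ball: `|x − y|^{-p} ≤ ((1+|x|)/2)^{-p}` for `|x − y| ≥ (1+|x|)/2`, `p ≥ 0`. -/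
theorem norm_sub_rpow_neg_le_of_not_mem_ball {p : ℝ} (hp : 0 ≤ p) {x y : EuclideanSpace ℝ (Fin 3)}
    (hy : y ∉ ball x ((1 + ‖x‖) / 2)) :
    ‖x - y‖ ^ (-p) ≤ ((1 + ‖x‖) / 2) ^ (-p) := by
  rw [mem_ball, dist_eq_norm, not_lt, norm_sub_rev] at hy
  have h3 : 0 < (1 + ‖x‖) / 2 := by linarith [norm_nonneg x]
  exact rpow_le_rpow_of_nonpos h3 hy (by linarith)

/-- Exterior region: for `|y| ≥ 2(1+|x|)`, `|x − y|^{-p} (1+|y|)^{-k} ≤ 2^p |y|^{-(p+k)}` (`p, k ≥ 0`). -/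
theorem norm_sub_rpow_neg_mul_weight_rpow_neg_le_of_not_mem_ball {p k : ℝ} (hp : 0 ≤ p) (hk : 0 ≤ k)
    {x y : EuclideanSpace ℝ (Fin 3)} (hy : y ∉ ball (0 : EuclideanSpace ℝ (Fin 3)) (2 * (1 + ‖x‖))) :
    ‖x - y‖ ^ (-p) * (1 + ‖y‖) ^ (-k) ≤ (2:ℝ) ^ p * ‖y‖ ^ (-(p + k)) := by
  rw [mem_ball_zero_iff, not_lt] at hy
  have hy0 : 0 < ‖y‖ := by linarith [norm_nonneg x]
  have hyne : y ≠ 0 := norm_pos_iff.1 hy0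
  have h1 : ‖y‖ - ‖x‖ ≤ ‖x - y‖ := by rw [norm_sub_rev]; exact norm_sub_norm_le y x
  have h2 : ‖y‖ / 2 ≤ ‖x - y‖ := by linarith [norm_nonneg x]
  have hA : ‖x - y‖ ^ (-p) ≤ (2:ℝ) ^ p * ‖y‖ ^ (-p) := by
    calc ‖x - y‖ ^ (-p) ≤ (‖y‖ / 2) ^ (-p) := rpow_le_rpow_of_nonpos (by positivity) h2 (by linarith)
      _ = (2:ℝ) ^ p * ‖y‖ ^ (-p) := by
          rw [div_rpow hy0.le zero_le_two, rpow_neg zero_le_two, rpow_neg hy0.le]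
          field_simp
  have hB : (1 + ‖y‖) ^ (-k) ≤ ‖y‖ ^ (-k) := rpow_le_rpow_of_nonpos hy0 (by linarith) (by linarith)
  calc ‖x - y‖ ^ (-p) * (1 + ‖y‖) ^ (-k) ≤ ((2:ℝ) ^ p * ‖y‖ ^ (-p)) * ‖y‖ ^ (-k) :=
        mul_le_mul hA hB (rpow_nonneg (by positivity) _) (by positivity)
    _ = (2:ℝ) ^ p * ‖y‖ ^ (-(p + k)) := by rw [mul_assoc, ← rpow_add hy0]; congr 2; ring

/-- **`∫ |x − y|^{-p} (1+|y|)^{-k} dy ≤ C_{p,k} V (1+|x|)^{3−p−k}`** for `0 < p < 3`, `0 ≤ k < 3`, `p + k > 3` (in `ℝ≥0∞`). -/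
theorem lintegral_norm_sub_rpow_neg_mul_weight_rpow_neg_le {p k : ℝ} (hp0 : 0 < p) (hp3 : p < 3) (hk0 : 0 ≤ k)
    (hk3 : k < 3) (hpk : 3 < p + k) (x : EuclideanSpace ℝ (Fin 3)) :
    ∫⁻ y, ENNReal.ofReal (‖x - y‖ ^ (-p) * (1 + ‖y‖) ^ (-k)) ≤
      ENNReal.ofReal (((2:ℝ) ^ (p + k - 3) / (3 - p) + (2:ℝ) ^ (p + 3 - k) / (3 - k) + (2:ℝ) ^ (3 - k) / (p + k - 3)) *
        (3 * (volume : Measure (EuclideanSpace ℝ (Fin 3))).real (ball 0 1)) * (1 + ‖x‖) ^ (3 - p - k)) := by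
  set ρ : ℝ := 1 + ‖x‖ with hρ
  have hρ1 : 1 ≤ ρ := by rw [hρ]; linarith [norm_nonneg x]
  have hρ0 : 0 < ρ := by linarith
  set V : ℝ := 3 * (volume : Measure (EuclideanSpace ℝ (Fin 3))).real (ball 0 1) with hV
  have hV0 : 0 ≤ V := three_mul_volume_real_ball_nonneg
  set f : EuclideanSpace ℝ (Fin 3) → ℝ≥0∞ := fun y => ENNReal.ofReal (‖x - y‖ ^ (-p) * (1 + ‖y‖) ^ (-k)) with hf
  set S : Set (EuclideanSpace ℝ (Fin 3)) := ball x (ρ / 2) with hS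
  set T : Set (EuclideanSpace ℝ (Fin 3)) := ball (0 : EuclideanSpace ℝ (Fin 3)) (2 * ρ) with hT
  have hSm : MeasurableSet S := measurableSet_ball
  have hTm : MeasurableSet T := measurableSet_ball
  have h3p : 0 < 3 - p := by linarith
  have h3k : 0 < 3 - k := by linarith
  have hpk' : 0 < p + k - 3 := by linarith
  have hc1 : 0 ≤ (ρ / 2) ^ (-k) := rpow_nonneg (by positivity) _
  have hc2 : 0 ≤ (ρ / 2) ^ (-p) := rpow_nonneg (by positivity) _
  -- (1) the near ball
  have h1 : ∫⁻ y in S, f y ≤ ENNReal.ofReal ((2:ℝ) ^ (p + k - 3) / (3 - p) * V * ρ ^ (3 - p - k)) := by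
    calc ∫⁻ y in S, f y ≤ ∫⁻ y in S, ENNReal.ofReal ((ρ / 2) ^ (-k)) * ENNReal.ofReal (‖x - y‖ ^ (-p)) := by
          refine setLIntegral_mono' hSm fun y hy => ?_
          rw [← ENNReal.ofReal_mul hc1, mul_comm ((ρ / 2) ^ (-k))]
          exact ENNReal.ofReal_le_ofReal
            (mul_le_mul_of_nonneg_left (weight_rpow_neg_le_of_mem_ball hk0 hy) (rpow_nonneg (norm_nonneg _) _))
      _ = ENNReal.ofReal ((ρ / 2) ^ (-k)) * ∫⁻ y in S, ENNReal.ofReal (‖x - y‖ ^ (-p)) :=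
          lintegral_const_mul' _ _ ENNReal.ofReal_ne_top
      _ = ENNReal.ofReal ((ρ / 2) ^ (-k)) * ENNReal.ofReal (V * ((ρ / 2) ^ (3 - p) / (3 - p))) := by
          rw [hS, lintegral_ball_comp_sub_left (fun z => ENNReal.ofReal (‖z‖ ^ (-p))) x (ρ / 2),
            lintegral_ball_norm_rpow_neg hp3 (by positivity)]
      _ = ENNReal.ofReal ((2:ℝ) ^ (p + k - 3) / (3 - p) * V * ρ ^ (3 - p - k)) := by
          rw [← ENNReal.ofReal_mul hc1]
          congr 1
          have e1 : (ρ / 2) ^ (-k) * (ρ / 2) ^ (3 - p) = (ρ / 2) ^ (3 - p - k) := by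
            rw [← rpow_add (by positivity)]; congr 1; ring
          have e2 : (ρ / 2) ^ (3 - p - k) = ρ ^ (3 - p - k) * (2:ℝ) ^ (p + k - 3) := by
            rw [div_rpow hρ0.le zero_le_two, show p + k - 3 = -(3 - p - k) by ring, rpow_neg zero_le_two]
            ring
          calc (ρ / 2) ^ (-k) * (V * ((ρ / 2) ^ (3 - p) / (3 - p)))
              = V / (3 - p) * ((ρ / 2) ^ (-k) * (ρ / 2) ^ (3 - p)) := by ring
            _ = _ := by rw [e1, e2]; ring
  -- (2) the annulus `Sᶜ ∩ T`
  have hae : ∀ᵐ y ∂(volume : Measure (EuclideanSpace ℝ (Fin 3))), y ≠ 0 := ae_ne_zero_volume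
  have hT2 : ∫⁻ y in T, ENNReal.ofReal ((1 + ‖y‖) ^ (-k)) ≤ ENNReal.ofReal (V * ((2 * ρ) ^ (3 - k) / (3 - k))) := by
    calc ∫⁻ y in T, ENNReal.ofReal ((1 + ‖y‖) ^ (-k)) ≤ ∫⁻ y in T, ENNReal.ofReal (‖y‖ ^ (-k)) := by
          refine lintegral_mono_ae (ae_restrict_of_ae ?_)
          filter_upwards [hae] with y hy
          exact ENNReal.ofReal_le_ofReal (rpow_le_rpow_of_nonpos (norm_pos_iff.2 hy) (by linarith) (by linarith))
      _ = ENNReal.ofReal (V * ((2 * ρ) ^ (3 - k) / (3 - k))) := by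
          rw [hT, lintegral_ball_norm_rpow_neg hk3 (by positivity)]
  have h2 : ∫⁻ y in Sᶜ ∩ T, f y ≤ ENNReal.ofReal ((2:ℝ) ^ (p + 3 - k) / (3 - k) * V * ρ ^ (3 - p - k)) := by
    calc ∫⁻ y in Sᶜ ∩ T, f y ≤ ∫⁻ y in Sᶜ ∩ T, ENNReal.ofReal ((ρ / 2) ^ (-p)) * ENNReal.ofReal ((1 + ‖y‖) ^ (-k)) := by
          refine setLIntegral_mono' (hSm.compl.inter hTm) fun y hy => ?_
          rw [← ENNReal.ofReal_mul hc2]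
          exact ENNReal.ofReal_le_ofReal
            (mul_le_mul_of_nonneg_right (norm_sub_rpow_neg_le_of_not_mem_ball hp0.le hy.1) (rpow_nonneg (by positivity) _))
      _ = ENNReal.ofReal ((ρ / 2) ^ (-p)) * ∫⁻ y in Sᶜ ∩ T, ENNReal.ofReal ((1 + ‖y‖) ^ (-k)) :=
          lintegral_const_mul' _ _ ENNReal.ofReal_ne_top
      _ ≤ ENNReal.ofReal ((ρ / 2) ^ (-p)) * ∫⁻ y in T, ENNReal.ofReal ((1 + ‖y‖) ^ (-k)) :=
          mul_le_mul' le_rfl (lintegral_mono_set inter_subset_right)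
      _ ≤ ENNReal.ofReal ((ρ / 2) ^ (-p)) * ENNReal.ofReal (V * ((2 * ρ) ^ (3 - k) / (3 - k))) := mul_le_mul' le_rfl hT2
      _ = ENNReal.ofReal ((2:ℝ) ^ (p + 3 - k) / (3 - k) * V * ρ ^ (3 - p - k)) := by
          rw [← ENNReal.ofReal_mul hc2]
          congr 1
          have e1 : (ρ / 2) ^ (-p) = (2:ℝ) ^ p * ρ ^ (-p) := by
            rw [div_rpow hρ0.le zero_le_two, rpow_neg zero_le_two, rpow_neg hρ0.le]; field_simp
          have e2 : (2 * ρ) ^ (3 - k) = (2:ℝ) ^ (3 - k) * ρ ^ (3 - k) := mul_rpow zero_le_two hρ0.le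
          have e3 : ρ ^ (-p) * ρ ^ (3 - k) = ρ ^ (3 - p - k) := by rw [← rpow_add hρ0]; congr 1; ring
          have e4 : (2:ℝ) ^ p * (2:ℝ) ^ (3 - k) = (2:ℝ) ^ (p + 3 - k) := by rw [← rpow_add two_pos]; congr 1; ring
          calc (ρ / 2) ^ (-p) * (V * ((2 * ρ) ^ (3 - k) / (3 - k)))
              = V / (3 - k) * ((2:ℝ) ^ p * (2:ℝ) ^ (3 - k)) * (ρ ^ (-p) * ρ ^ (3 - k)) := by rw [e1, e2]; ring
            _ = _ := by rw [e3, e4]; ring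
  -- (3) the exterior `Sᶜ \ T`
  have h3 : ∫⁻ y in Sᶜ \ T, f y ≤ ENNReal.ofReal ((2:ℝ) ^ (3 - k) / (p + k - 3) * V * ρ ^ (3 - p - k)) := by
    have hc3 : 0 ≤ (2:ℝ) ^ p := by positivity
    calc ∫⁻ y in Sᶜ \ T, f y ≤ ∫⁻ y in Sᶜ \ T, ENNReal.ofReal ((2:ℝ) ^ p) * ENNReal.ofReal (‖y‖ ^ (-(p + k))) := by
          refine setLIntegral_mono' (hSm.compl.diff hTm) fun y hy => ?_
          rw [← ENNReal.ofReal_mul hc3]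
          exact ENNReal.ofReal_le_ofReal (norm_sub_rpow_neg_mul_weight_rpow_neg_le_of_not_mem_ball hp0.le hk0 hy.2)
      _ = ENNReal.ofReal ((2:ℝ) ^ p) * ∫⁻ y in Sᶜ \ T, ENNReal.ofReal (‖y‖ ^ (-(p + k))) :=
          lintegral_const_mul' _ _ ENNReal.ofReal_ne_top
      _ ≤ ENNReal.ofReal ((2:ℝ) ^ p) * ∫⁻ y in Tᶜ, ENNReal.ofReal (‖y‖ ^ (-(p + k))) :=
          mul_le_mul' le_rfl (lintegral_mono_set fun y hy => hy.2)
      _ = ENNReal.ofReal ((2:ℝ) ^ p) * ENNReal.ofReal (V * ((2 * ρ) ^ (3 - (p + k)) / ((p + k) - 3))) := by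
          rw [hT, lintegral_compl_ball_norm_rpow_neg hpk (by positivity)]
      _ = ENNReal.ofReal ((2:ℝ) ^ (3 - k) / (p + k - 3) * V * ρ ^ (3 - p - k)) := by
          rw [← ENNReal.ofReal_mul hc3]
          congr 1
          have e2 : (2 * ρ) ^ (3 - (p + k)) = (2:ℝ) ^ (3 - (p + k)) * ρ ^ (3 - p - k) := by
            rw [mul_rpow zero_le_two hρ0.le, show 3 - (p + k) = 3 - p - k by ring]
          have e4 : (2:ℝ) ^ p * (2:ℝ) ^ (3 - (p + k)) = (2:ℝ) ^ (3 - k) := by rw [← rpow_add two_pos]; congr 1; ring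
          calc (2:ℝ) ^ p * (V * ((2 * ρ) ^ (3 - (p + k)) / (p + k - 3)))
              = V / (p + k - 3) * ((2:ℝ) ^ p * (2:ℝ) ^ (3 - (p + k))) * ρ ^ (3 - p - k) := by rw [e2]; ring
            _ = _ := by rw [e4]; ring
  -- assemble
  calc ∫⁻ y, f y = (∫⁻ y in S, f y) + ∫⁻ y in Sᶜ, f y := (lintegral_add_compl f hSm).symm
    _ = (∫⁻ y in S, f y) + ((∫⁻ y in Sᶜ ∩ T, f y) + ∫⁻ y in Sᶜ \ T, f y) := by
        rw [lintegral_inter_add_sdiff f Sᶜ hTm]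
    _ ≤ ENNReal.ofReal ((2:ℝ) ^ (p + k - 3) / (3 - p) * V * ρ ^ (3 - p - k)) +
          (ENNReal.ofReal ((2:ℝ) ^ (p + 3 - k) / (3 - k) * V * ρ ^ (3 - p - k)) +
            ENNReal.ofReal ((2:ℝ) ^ (3 - k) / (p + k - 3) * V * ρ ^ (3 - p - k))) :=
        add_le_add h1 (add_le_add h2 h3)
    _ = _ := by
        have hA : 0 ≤ (2:ℝ) ^ (p + k - 3) / (3 - p) * V * ρ ^ (3 - p - k) := by positivity
        have hB : 0 ≤ (2:ℝ) ^ (p + 3 - k) / (3 - k) * V * ρ ^ (3 - p - k) := by positivity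
        have hC : 0 ≤ (2:ℝ) ^ (3 - k) / (p + k - 3) * V * ρ ^ (3 - p - k) := by positivity
        rw [← ENNReal.ofReal_add hB hC, ← ENNReal.ofReal_add hA (add_nonneg hB hC)]
        congr 1
        ring

/-- Real-valued form with integrability. -/
theorem integral_norm_sub_rpow_neg_mul_weight_rpow_neg_le {p k : ℝ} (hp0 : 0 < p) (hp3 : p < 3) (hk0 : 0 ≤ k)
    (hk3 : k < 3) (hpk : 3 < p + k) (x : EuclideanSpace ℝ (Fin 3)) :
    Integrable (fun y => ‖x - y‖ ^ (-p) * (1 + ‖y‖) ^ (-k)) (volume : Measure (EuclideanSpace ℝ (Fin 3))) ∧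
    ∫ y, ‖x - y‖ ^ (-p) * (1 + ‖y‖) ^ (-k) ≤
      ((2:ℝ) ^ (p + k - 3) / (3 - p) + (2:ℝ) ^ (p + 3 - k) / (3 - k) + (2:ℝ) ^ (3 - k) / (p + k - 3)) *
        (3 * (volume : Measure (EuclideanSpace ℝ (Fin 3))).real (ball 0 1)) * (1 + ‖x‖) ^ (3 - p - k) := by
  have hV0 : 0 ≤ 3 * (volume : Measure (EuclideanSpace ℝ (Fin 3))).real (ball 0 1) := three_mul_volume_real_ball_nonneg
  have hρ0 : 0 < 1 + ‖x‖ := by linarith [norm_nonneg x]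
  have h3p : 0 < 3 - p := by linarith
  have h3k : 0 < 3 - k := by linarith
  have hpk' : 0 < p + k - 3 := by linarith
  have hnn : ∀ y, 0 ≤ ‖x - y‖ ^ (-p) * (1 + ‖y‖) ^ (-k) := fun y =>
    mul_nonneg (rpow_nonneg (norm_nonneg _) _) (rpow_nonneg (by positivity) _)
  have hmeas : AEStronglyMeasurable (fun y => ‖x - y‖ ^ (-p) * (1 + ‖y‖) ^ (-k))
      (volume : Measure (EuclideanSpace ℝ (Fin 3))) := by
    refine (Measurable.mul ?_ ?_).aestronglyMeasurable
    · exact ((continuous_const.sub continuous_id).norm.measurable).pow_const _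
    · exact (continuous_const.add continuous_norm).measurable.pow_const _
  have hlt := lintegral_norm_sub_rpow_neg_mul_weight_rpow_neg_le hp0 hp3 hk0 hk3 hpk x
  have hfin : HasFiniteIntegral (fun y => ‖x - y‖ ^ (-p) * (1 + ‖y‖) ^ (-k))
      (volume : Measure (EuclideanSpace ℝ (Fin 3))) := by
    refine lt_of_le_of_lt ?_ (hlt.trans_lt ENNReal.ofReal_lt_top)
    refine lintegral_mono fun y => ?_
    rw [Real.enorm_eq_ofReal (hnn y)]
  refine ⟨⟨hmeas, hfin⟩, ?_⟩
  rw [integral_eq_lintegral_of_nonneg_ae (Eventually.of_forall hnn) hmeas]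
  exact ENNReal.toReal_le_of_le_ofReal (by positivity) hlt

end Summit.NavierStokesRegularity.NavierStokesRegularity.Theorems.KelvinGate

end
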